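import Summits.QuantumFields.YangMills.Theorems.AlphaInputsT3ACv4SeamWindowDL
import Summits.QuantumFields.YangMills.Theorems.AlphaInputsT3ACv3InClassSelXsOfNestedRegularR7
import HarnessLib

/-!
# `AlphaInputsT3ACv4RecordNestedR7` — «B1 BY NAME, v2 (R7)» AS ONE DISPLAY: 2′χ-v4 from [7] Thm 1 + the record sizes + the PINNED NESTED-REGULAR MINIMISER SELECTION OVER THE
# (7)-SET (`NestedRegularSelT3R7`) with its χ-data — the additive (R2) re-display of ✓`AlphaInputsT3ACv4RecordNested` over LEAD's EDGES-A v2 predicate — lane `pub-balaban3d`, width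
# seat alpha-2 (g10; v4 package ∕ display owner; ★★OWNER RULING №24 (3), LEAD L-R3 ∕ L-R6)

WHY (cell `ym3-torus`, route `UnitScaleTilt`, crux `HistoryTailL` = stmt-QuantumFields-19936; stub 2′χ-v4 `AlphaInputsT3ACv4RecChi`).  The nested display of record
✓`AlphaInputsT3AC.PinnedPartsT3ACRecNestedV4Chi` (this seat, g7) reads its selection through ✓`NestedRegularSelT3` (v1), which is TRUE-BUT-VACUOUS for `K ≥ K₀` (V4-VORTEX, ★w6-19936 g3,
19936 evidence #49; LEAD L-R3): nested regularity (2) at level `0` is GLOBAL (`Ω₀ = T`) and is asked for EVERY top datum `W`, vortex data included.  LEAD ★w1-19936 g4's EDGES-A v2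
✓`AlphaInputsT3AC.NestedRegularSelT3R7` (`…v3InClassSelXsOfNestedRegularR7`, on ★w2-19936 g6's «B1 STATEMENT SPEC» #47) repairs the ORDER of quantifiers: the pinned nested-regular
structure (2) + (3) is asked ONLY for top data on the (7)-SET `𝒟₇(k,h) = AlphaInputsT3AC.data7Set … k h ε₁` (jointly (7)-regular, recorded-large multi-level data, (0.4)-small below
the top); off it the selection is a free point of the one-currency class `𝒞_Xs`.  THIS FILE re-displays the record over it, additively (✓`…v4RecordNested` untouched):
* §1 (O⁗χ-R7) `AlphaInputsT3AC.DataRowsT3NestedR7ChiSel K Ut` := `∃ UkH hU0 ε₁, (∀ j < K, eps1Of j < ε₁ j) ∧ NestedRegularSelT3R7 K ε₁ Ut UkH ∧ ∃ 𝔖 𝔄, «the three χ data conjuncts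
  VERBATIM»`.  THE RADII `ε₁` ARE BOUND EXISTENTIALLY NEXT TO `UkH` (the supplier's choice — [Balaban1985UV3] (7) p.257 takes `ε₁ = g_k p(g_k)` at step `k`, i.e. θ-small and
  run-dependent, strictly above `eps1Of j = g_j p(g_j)` at the data levels `j < k`) WITH THE STRICT RECORDING FLOOR `eps1Of j < ε₁ j` (LEAD's consistency note: `𝒟₇(k,h) ≠ ∅` at
  every history — the recorded plaquettes sit in the open window `(eps1Of j, ε₁ j)` — so the display is not escaped through the off-clause).  DISPLAY-OWNER CAVEAT (located, reading-level): the on-clause still carries (2) at `i = 0` on `Ω₀ = T`; it is non-vacuous only because θ-small `ε₁` keep tube-vortex data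
  OFF `π_k(𝒟₇)` (a fine datum on the solid tube, `ε₁ 0`-regular, whose one-step averages on the tube's boundary rings carry holonomy `−1` needs ≈ `4T²L²·ε₁(0) ≳ 2` by lattice Stokes,
  `T` = tube half-width in level-1 blocks); an O(1) `ε₁` ([Balaban1985Variational]'s constant) would re-admit the V4 vortex.  `dataRowsT3XsChiSel_of_nestedR7 (hM₁)` ((O⁗χ-R7) ⇒
  (O‴χₛ), LEAD's ★★★ `inClassSelT3Xs_of_nestedRegularSelR7`);
* §2 the record display `AlphaInputsT3AC.PinnedPartsT3ACRecNestedR7V4Chi L` = ✓`PinnedPartsT3ACRecNestedV4Chi L` with (O⁗χ) ↦ (O⁗χ-R7), every other row byte-identical (thresholds,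
  `∀ φ` numeral-free `γ₀`-tolerance row, sizes, `C68`-rows, collar `7L + 3 ≤ M₁`, [7] Thm 1);
* §3 the closers at EVERY ODD `L > 1` (the `_dL` numerals of ✓`…v4SeamWindowDL`; no floor): ★ `pinnedPartsT3ACRecSelXsV4Chi_of_nestedR7_dL` (NOTHING LOST: the R7 display implies the
  display of record `PinnedPartsT3ACRecSelXsV4Chi`) and ★★★ `alphaInputsT3ACv4RecChi_of_pinnedPartsRecNestedR7V4Chi_dL : PinnedPartsT3ACRecNestedR7V4Chi L → AlphaInputsT3ACv4RecChi L`;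
* §4 the one-supplier form: `pinnedPartsT3ACRecNestedR7V4Chi_of_thm1_rows` and ★★★ `HistoryTailSelSupplier.laneRecordsV4Chi_of_thm1In8_nestedR7DataRows_dL : ⟨T8 text⟩ → ⟨∀ odd
  L > 1: floor∕box rows with `∀ φ` and (O⁗χ-R7)⟩ → ∀ L, Odd L → 1 < L → AlphaInputsT3ACv4RecChi L` — the v5p10 stub text's shape.
The constants-and-rows shell of §2 (every row except (T) and the per-family clause) is ✓`AlphaInputsT3AC.pinnedPartsT3ACRecNestedV4Chi_shell` VERBATIM (the two records share those rows).
HONEST FRAMING.  `def … : Prop` below are HYPOTHESIS SCHEMAS, OPEN, never asserted; the theorems are bookkeeping around DISPLAYED rows.  `NestedRegularSelT3R7` stands for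
[Balaban1985Variational] Thm 1's output for print's (42)-minimiser map over jointly (7)-regular data (EDGES-B ∕ NODE O, NOT proved); (O⁗χ-R7)'s data conjuncts are [Balaban1985UV3]
Sect. B–C (NODE O, NOT proved); the display of record for NODE O's debt stays the JOINT ∃ door ✓`historyTailL_of_thm1In8_selXsV4DataRows_allL` (★★OWNER RULING №29 (4)) — this file
only adds a STRONGER, print-shaped sufficient display next to it.  Count-neutral helper (`--supports stmt-QuantumFields-19936`); registry and binders untouched.  YM₃ on the three-torus
is rung R3 of the programme, NOT the Clay problem: nothing here bears on d = 4, infinite volume, or a mass gap.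

References: T. Bałaban, Commun. Math. Phys. 102 (1985) 255–275 [Balaban1985UV3] (Thm 2 p.272, (4)∕(7) p.257, (40)–(42) p.266, p.267 l.1–3, (47) p.267, (67)–(71) p.273); Commun.
Math. Phys. 102 (1985) 277–309 [Balaban1985Variational] ((2)–(3) p.278, (7) p.278, Thm 1 (6)–(8) pp.278–279).
-/

set_option autoImplicit false

noncomputable section

namespace Summit.QuantumFields.YangMills.Theorems

open MeasureTheory Set
open scoped Matrix Matrix.Norms.L2Operator
open Literature.MathematicalPhysics.QuantumFieldTheory.Balaban1983to89
open Literature.MathematicalPhysics.QuantumFieldTheory.Balaban1983to89.T3ContinuumYM3Torus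
open Literature.MathematicalPhysics.QuantumFieldTheory.Balaban1983to89.T3UnitScaleTilt (θBal)
open Literature.MathematicalPhysics.QuantumFieldTheory.Balaban1983to89.T3PrintedMinimiserExistence (Thm1GlobalMinAt)
open Literature.MathematicalPhysics.QuantumFieldTheory.Balaban1983to89.T3LowerAlongMinimisersSplit (MinimisersIn8At)
open Literature.MathematicalPhysics.QuantumFieldTheory.Balaban1983to89.ExpMeanLog (deltaSU)
open Literature.MathematicalPhysics.QuantumFieldTheory.Balaban1985CMP102.Setting
open Summit.QuantumFields.Balaban3D.Carriers
open Summit.QuantumFields.Balaban3D.Proofs.Primitives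
open Summit.QuantumFields.Balaban3D.Proofs.GroupModelLieC (lieC)
open Summit.QuantumFields.Balaban3D.Proofs.StandardAC
open Summit.QuantumFields.Balaban3D.Proofs.InputsAC
open Summit.QuantumFields.Balaban3D.Proofs.AlphaAC (AlphaDataAC)
open Summit.QuantumFields.Balaban3D.Proofs.Thresholds (Q0 Q0_pos)
open Summit.QuantumFields.YangMills.Theorems.AlphaV3AC
open B7Prop2Explicit (C0 C0_pos)

/-! ## §1 (O⁗χ-R7): the χ data rows for a pinned nested-regular selection over the (7)-set -/

section Schema

variable (F : T3Family) (𝔠 : AlphaConsts F.L (suGroupModel 2).N) (γ : ℝ) (hγ : 0 < γ) (hγ1 : γ ≤ (min 𝔠.gamma0 1) ^ 2)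

/-- **(O⁗χ-R7) THE χ CLUSTER-EXPANSION DATA ROWS FOR A PINNED NESTED-REGULAR SELECTION OVER THE (7)-SET** (hypothesis schema, never asserted): `DataRowsT3XsChiSel` with the in-class row
`InClassSelT3Xs` REPLACED by LEAD's EDGES-A v2 predicate `NestedRegularSelT3R7 … ε₁ Ut UkH` — print's (42)-minimiser map: pinned at the trivial history, measurable, and at every
admissible non-trivial history: a free `𝒞_Xs`-point off the (7)-set `𝒟₇(k,h)`, on it nested-regular (2) on the regions and pinned by the multi-level constraint (3) to jointly
(7)-regular recorded-large data extending the top datum — for SOME radii `ε₁ : ℕ → ℝ` STRICTLY ABOVE THE RECORDING FLOOR, `eps1Of j < ε₁ j` for `j < K` (the supplier's choice,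
meant θ-small; [Balaban1985UV3] (7) p.257 takes `ε₁ = g_k p(g_k)` at step `k`, above `g_j p(g_j)` for the data levels `j < k`), and the three data conjuncts VERBATIM.
[cite: Balaban1985Variational, (2)–(3) p.278, (7) p.278, Thm 1 (8) p.279; Balaban1985UV3, (7) p.257, Thm 2 p.272 + (41)–(42) p.266 + (47) p.267 + (67)–(68) p.273] -/
def AlphaInputsT3AC.DataRowsT3NestedR7ChiSel (K : ℕ)
    (Ut : (k : ℕ) → GaugeField (F.P K) k (Matrix.specialUnitaryGroup (Fin 2) ℂ) → GaugeField (F.P K) 0 (Matrix.specialUnitaryGroup (Fin 2) ℂ)) : Prop :=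
  ∃ (UkH : (k : ℕ) → Hist (F.P K) k → GaugeField (F.P K) k (Matrix.specialUnitaryGroup (Fin 2) ℂ) →
      GaugeField (F.P K) 0 (Matrix.specialUnitaryGroup (Fin 2) ℂ))
    (hU0 : ∀ V : GaugeField (F.P K) 0 (Matrix.specialUnitaryGroup (Fin 2) ℂ), UkH 0 (Hist.triv (F.P K) 0) V = V)
    (ε₁ : ℕ → ℝ),
    (∀ j, j < K → eps1Of (T3Scales F γ hγ (hγ1.trans (sq_min_one_le _ 𝔠.gamma0_pos)) K) 𝔠.lane.carrier j < ε₁ j) ∧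
    AlphaInputsT3AC.NestedRegularSelT3R7 F 𝔠 γ hγ hγ1 K ε₁ Ut UkH ∧
    ∃ (𝔖 : ∀ k, StepSeries (T3Scales F γ hγ (hγ1.trans (sq_min_one_le _ 𝔠.gamma0_pos)) K)
        (Matrix.specialUnitaryGroup (Fin 2) ℂ) ↥(lieC (suGroupModel 2))
        (nblkOf (T3Scales F γ hγ (hγ1.trans (sq_min_one_le _ 𝔠.gamma0_pos)) K) 𝔠.lane.carrier k) k)
      (𝔄 : AlphaDataAC (suGroupModel 2) 𝔠
        (XT3 F γ hγ (hγ1.trans (sq_min_one_le _ 𝔠.gamma0_pos)) K (fun _ => Set.univ)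
          (fun k => UkH (k + 1) (Hist.triv (F.P K) (k + 1))) UkH hU0 (fun _ _ => rfl)) 𝔖),
      (∀ k, k + 1 ≤ K → StepDataV3ChiAC (suGroupModel 2) 𝔠
        (XT3 F γ hγ (hγ1.trans (sq_min_one_le _ 𝔠.gamma0_pos)) K (fun _ => Set.univ)
          (fun k => UkH (k + 1) (Hist.triv (F.P K) (k + 1))) UkH hU0 (fun _ _ => rfl)) 𝔖 𝔄
        (AlphaInputsT3AC.admWindowT3 F 𝔠 γ hγ hγ1 K) k) ∧
      (∀ h : Hist (F.P K) K, Measurable ((inputOfAC 𝔠.lane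
        (XT3 F γ hγ (hγ1.trans (sq_min_one_le _ 𝔠.gamma0_pos)) K (fun _ => Set.univ)
          (fun k => UkH (k + 1) (Hist.triv (F.P K) (k + 1))) UkH hU0 (fun _ _ => rfl)) 𝔖).Pint K h)) ∧
      (∀ (h : Hist (F.P K) K) (U : GaugeField (F.P K) K (Matrix.specialUnitaryGroup (Fin 2) ℂ)), (inputOfAC 𝔠.lane
        (XT3 F γ hγ (hγ1.trans (sq_min_one_le _ 𝔠.gamma0_pos)) K (fun _ => Set.univ)
          (fun k => UkH (k + 1) (Hist.triv (F.P K) (k + 1))) UkH hU0 (fun _ _ => rfl)) 𝔖).Pint K h U ≤ 𝔄.cP K)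

variable {F 𝔠 γ hγ hγ1}

/-- **(O⁗χ-R7) ⇒ (O‴χₛ) UNDER THE COLLAR** (LEAD's `inClassSelT3Xs_of_nestedRegularSelR7`: the pinned nested-regular selection over the (7)-set is an in-class selection over `𝒞_Xs`;
same map, same data; the radii `ε₁` and their floor are forgotten). [cite: Balaban1985Variational, Thm 1 (8) p.279, (7) p.278; Balaban1985UV3, (42) p.266 + (67)–(68) p.273] -/
theorem AlphaInputsT3AC.dataRowsT3XsChiSel_of_nestedR7 {K : ℕ} (hM₁ : 7 * F.L + 3 ≤ 𝔠.M₁)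
    {Ut : (k : ℕ) → GaugeField (F.P K) k (Matrix.specialUnitaryGroup (Fin 2) ℂ) → GaugeField (F.P K) 0 (Matrix.specialUnitaryGroup (Fin 2) ℂ)}
    (hD : AlphaInputsT3AC.DataRowsT3NestedR7ChiSel F 𝔠 γ hγ hγ1 K Ut) : AlphaInputsT3AC.DataRowsT3XsChiSel F 𝔠 γ hγ hγ1 K Ut := by
  obtain ⟨UkH, hU0, ε₁, -, hsel, 𝔖, 𝔄, hsteps, hPm, hPb⟩ := hD
  exact ⟨UkH, hU0, AlphaInputsT3AC.inClassSelT3Xs_of_nestedRegularSelR7 hM₁ hsel, 𝔖, 𝔄, hsteps, hPm, hPb⟩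

end Schema

/-! ## §2 The record display: pinned nested-regular selection over the (7)-set, collar, and a numeral-free `γ₀`-tolerance row -/

/-- **2′χ (VERSION 4) DISPLAYED WITH THE PINNED NESTED-REGULAR SELECTION OVER THE (7)-SET AND A NUMERAL-FREE `γ₀`-TOLERANCE ROW** (hypothesis schema, OPEN, never asserted): thresholds
`(b₁, p₁)`; for every profile beyond them AND every tolerance `φ : ℝ → ℝ` positive on `(0, ∞)`, record constants `𝔠` with that profile and `(a₀, a₁)` such that: the sizes, `1 ≤ 2B₃`,
the `C68`-rows, the collar `7L + 3 ≤ M₁`, `γ₀ ≤ ((φ(C68)∕(b₀Q₀(p₀)))²)²`, [7] Thm 1, and per family (O⁗χ-R7) for some pinned [7]-family whenever one exists — ✓`PinnedPartsT3ACRecNestedV4Chi L`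
with (O⁗χ) ↦ (O⁗χ-R7), every other row byte-identical.  NO seam conjunct, NO numerals.
[cite: Balaban1985UV3, (7) p.257, (40)–(42) p.266, (47) p.267, (67)–(71) p.273 and Thm 2 p.272; Balaban1985Variational, (2)–(3) p.278, (7) p.278, Thm 1 (6)–(8) pp.278–279] -/
def AlphaInputsT3AC.PinnedPartsT3ACRecNestedR7V4Chi (L : ℕ) : Prop :=
  ∃ (b₁ p₁ : ℝ), ∀ (b₀ p₀ : ℝ), b₁ ≤ b₀ → p₁ ≤ p₀ → ∀ (φ : ℝ → ℝ), (∀ x : ℝ, 0 < x → 0 < φ x) →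
    ∃ (𝔠 : AlphaConsts L (suGroupModel 2).N) (a₀ a₁ : ℝ), 𝔠.b₀ = b₀ ∧ 𝔠.p₀ = p₀ ∧ 0 < a₀ ∧ 0 < a₁ ∧ 𝔠.B₃ * a₁ ≤ a₀ ∧
      (143 * ((((3 + 4 : ℕ) : ℝ)) ^ 2 / 4) ^ 2) * (2 * (𝔠.B₃ * a₁)) ≤ 1 / 3 ∧
      2 * (2 * (𝔠.B₃ * a₁)) ≤ 2 * deltaSU (Fin 2) / (((3 + 4) * L : ℕ) : ℝ) ^ 2 ∧
      1 ≤ 2 * 𝔠.B₃ ∧ 4 * 𝔠.B₃ * (L : ℝ) ^ 2 * avgWindowFactor L ≤ 𝔠.C68 ∧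
      Real.exp (𝔠.p₀ - 1) ≤ 3 * C0 3 * 𝔠.C68 * (𝔠.b₀ * Q0 𝔠.p₀) ∧
      (𝔠.b₀ * Q0 𝔠.p₀) * (2 * (L : ℝ) ^ 2 * avgWindowFactor L) ^ 2 ≤ 3 * C0 3 * 𝔠.C68 * a₁ ^ 2 ∧
      7 * L + 3 ≤ 𝔠.M₁ ∧
      𝔠.gamma0 ≤ ((φ 𝔠.C68 / (𝔠.b₀ * Q0 𝔠.p₀)) ^ 2) ^ 2 ∧
      Thm1GlobalMinAt L a₀ a₁ 𝔠.B₃ ∧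
      ∀ (F : T3Family) (hF : F.L = L) (γ : ℝ) (hγ : 0 < γ) (hγ1 : γ ≤ (min (hF ▸ 𝔠).gamma0 1) ^ 2) (K : ℕ),
        (∃ Ut : (k : ℕ) → GaugeField (F.P K) k (Matrix.specialUnitaryGroup (Fin 2) ℂ) → GaugeField (F.P K) 0 (Matrix.specialUnitaryGroup (Fin 2) ℂ),
          AlphaInputsT3AC.TrivMinimiserRowsT3 F (hF ▸ 𝔠) γ hγ hγ1 a₀ a₁ K Ut) →
        ∃ Ut : (k : ℕ) → GaugeField (F.P K) k (Matrix.specialUnitaryGroup (Fin 2) ℂ) → GaugeField (F.P K) 0 (Matrix.specialUnitaryGroup (Fin 2) ℂ),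
          AlphaInputsT3AC.TrivMinimiserRowsT3 F (hF ▸ 𝔠) γ hγ hγ1 a₀ a₁ K Ut ∧ AlphaInputsT3AC.DataRowsT3NestedR7ChiSel F (hF ▸ 𝔠) γ hγ hγ1 K Ut

/-! ## §3 The closers at every odd `L > 1` (the floor-free `_dL` numerals instantiate the tolerance) -/

/-- At a family of block size `L`: the collar (stated with `L`) transports (O⁗χ-R7) to (O‴χₛ) for the constants `hF ▸ 𝔠`. [cite: Balaban1985Variational, Thm 1 (8) p.279; Balaban1985UV3, (42) p.266 + (67)–(68) p.273] -/
theorem AlphaInputsT3AC.selXsRows_of_nestedR7Rows_cast {L : ℕ} {𝔠 : AlphaConsts L (suGroupModel 2).N} {a₀ a₁ : ℝ} (hM₁ : 7 * L + 3 ≤ 𝔠.M₁)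
    (F : T3Family) (hF : F.L = L)
    (hN : ∀ (γ : ℝ) (hγ : 0 < γ) (hγ1 : γ ≤ (min (hF ▸ 𝔠).gamma0 1) ^ 2) (K : ℕ),
      (∃ Ut : (k : ℕ) → GaugeField (F.P K) k (Matrix.specialUnitaryGroup (Fin 2) ℂ) → GaugeField (F.P K) 0 (Matrix.specialUnitaryGroup (Fin 2) ℂ),
        AlphaInputsT3AC.TrivMinimiserRowsT3 F (hF ▸ 𝔠) γ hγ hγ1 a₀ a₁ K Ut) →
      ∃ Ut : (k : ℕ) → GaugeField (F.P K) k (Matrix.specialUnitaryGroup (Fin 2) ℂ) → GaugeField (F.P K) 0 (Matrix.specialUnitaryGroup (Fin 2) ℂ),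
        AlphaInputsT3AC.TrivMinimiserRowsT3 F (hF ▸ 𝔠) γ hγ hγ1 a₀ a₁ K Ut ∧ AlphaInputsT3AC.DataRowsT3NestedR7ChiSel F (hF ▸ 𝔠) γ hγ hγ1 K Ut) :
    ∀ (γ : ℝ) (hγ : 0 < γ) (hγ1 : γ ≤ (min (hF ▸ 𝔠).gamma0 1) ^ 2) (K : ℕ),
      (∃ Ut : (k : ℕ) → GaugeField (F.P K) k (Matrix.specialUnitaryGroup (Fin 2) ℂ) → GaugeField (F.P K) 0 (Matrix.specialUnitaryGroup (Fin 2) ℂ),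
        AlphaInputsT3AC.TrivMinimiserRowsT3 F (hF ▸ 𝔠) γ hγ hγ1 a₀ a₁ K Ut) →
      ∃ Ut : (k : ℕ) → GaugeField (F.P K) k (Matrix.specialUnitaryGroup (Fin 2) ℂ) → GaugeField (F.P K) 0 (Matrix.specialUnitaryGroup (Fin 2) ℂ),
        AlphaInputsT3AC.TrivMinimiserRowsT3 F (hF ▸ 𝔠) γ hγ hγ1 a₀ a₁ K Ut ∧ AlphaInputsT3AC.DataRowsT3XsChiSel F (hF ▸ 𝔠) γ hγ hγ1 K Ut := by
  subst hF
  intro γ hγ hγ1 K hex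
  obtain ⟨Ut, hUt, hNe⟩ := hN γ hγ hγ1 K hex
  exact ⟨Ut, hUt, AlphaInputsT3AC.dataRowsT3XsChiSel_of_nestedR7 hM₁ hNe⟩

/-- ★ **NOTHING LOST — THE R7 DISPLAY IMPLIES THE ONE-CURRENCY SEAM DISPLAY OF RECORD, every odd `L > 1`**: `PinnedPartsT3ACRecNestedR7V4Chi L → PinnedPartsT3ACRecSelXsV4Chi L` — the
tolerance instantiated with the floor-free numerals `φ C := D′(L, C)⁻¹` (✓`smallFactor71OfRecT3_of_gamma0_dL_cast`), (O⁗χ-R7) ⇒ (O‴χₛ) by the collar (`selXsRows_of_nestedR7Rows_cast`).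
[cite: Balaban1985UV3, (7) p.257 and (67)–(71) p.273; Balaban1985Variational, Thm 1 (8) p.279] -/
theorem AlphaInputsT3AC.pinnedPartsT3ACRecSelXsV4Chi_of_nestedR7_dL {L : ℕ} (h : AlphaInputsT3AC.PinnedPartsT3ACRecNestedR7V4Chi L) :
    AlphaInputsT3AC.PinnedPartsT3ACRecSelXsV4Chi L := by
  obtain ⟨b₁, p₁, h⟩ := h
  refine ⟨b₁, p₁, fun b₀ p₀ hb hp => ?_⟩
  obtain ⟨𝔠, a₀, a₁, h1, h2, h3, h4, h5, hA3, hA2, hB₃, hC, hCe, hCa, hM₁, hg, hT, hD⟩ := h b₀ p₀ hb hp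
    (fun C => (36288000 * (L : ℝ) ^ 2 * C +
      2 * (2 * C * ((11612160000 * (L : ℝ) ^ 2 + 1331529 / 4) * C ^ 2) + ((11612160000 * (L : ℝ) ^ 2 + 1331529 / 4) * C ^ 2) ^ 2) + 1)⁻¹)
    (fun C hC => by positivity)
  exact ⟨𝔠, a₀, a₁, h1, h2, h3, h4, h5, hA3, hA2, hB₃, hC, hCe, hCa, hT, fun F hF =>
    ⟨AlphaInputsT3AC.smallFactor71OfRecT3_of_gamma0_dL_cast hg F hF, AlphaInputsT3AC.selXsRows_of_nestedR7Rows_cast hM₁ F hF (hD F hF)⟩⟩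

/-- ★★★ **THE VERSION-4 STUB TEXT 2′χ FROM THE R7 DISPLAY, every odd `L > 1`**: `PinnedPartsT3ACRecNestedR7V4Chi L → AlphaInputsT3ACv4RecChi L` — 2′χ-v4 re-cut to «(T) [7] Thm 1 + the
record sizes + collar + a `γ₀`-tolerance row + (O⁗χ-R7) ONE pinned nested-regular minimiser selection over the (7)-set with its χ data rows»: NO seam, NO comb letter, NO (FL), NO floor.
[cite: Balaban1985UV3, Thm 2 p.272, (47) p.267 and (67)–(71) p.273; Balaban1985Variational, Thm 1 (8) p.279, (7) p.278] -/
theorem alphaInputsT3ACv4RecChi_of_pinnedPartsRecNestedR7V4Chi_dL {L : ℕ} (h : AlphaInputsT3AC.PinnedPartsT3ACRecNestedR7V4Chi L) :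
    AlphaInputsT3ACv4RecChi L :=
  alphaInputsT3ACv4RecChi_of_pinnedPartsRecSelXsV4Chi (AlphaInputsT3AC.pinnedPartsT3ACRecSelXsV4Chi_of_nestedR7_dL h)

end Summit.QuantumFields.YangMills.Theorems

/-! ## §4 The one-supplier form at every odd `L > 1` (the v5p10 stub text's shape) -/

namespace Summit.QuantumFields.YangMills.Theorems.HistoryTailSelSupplier

open MeasureTheory Set
open scoped Matrix.Norms.L2Operator
open Literature.MathematicalPhysics.QuantumFieldTheory.Balaban1983to89
open Literature.MathematicalPhysics.QuantumFieldTheory.Balaban1983to89.T3ContinuumYM3Torus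
open Literature.MathematicalPhysics.QuantumFieldTheory.Balaban1983to89.T3PrintedMinimiserExistence (Thm1GlobalMinAt)
open Literature.MathematicalPhysics.QuantumFieldTheory.Balaban1983to89.T3LowerAlongMinimisersSplit (MinimisersIn8At)
open Literature.MathematicalPhysics.QuantumFieldTheory.Balaban1983to89.ExpMeanLog (deltaSU)
open Literature.MathematicalPhysics.QuantumFieldTheory.Balaban1985CMP102.Setting
open Summit.QuantumFields.Balaban3D.Carriers
open Summit.QuantumFields.Balaban3D.Proofs.Primitives
open Summit.QuantumFields.Balaban3D.Proofs.Thresholds (Q0 Q0_pos)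
open Summit.QuantumFields.YangMills.Theorems.HistoryTailOneSupplier (exists_small_window)
open B7Prop2Explicit (C0 C0_pos)

/-- ★★ **THE R7 v4 DISPLAY FROM (T) AT ANY CONSTANTS AND THE SUPPLIER ROWS** — ✓`pinnedPartsT3ACRecNestedV4Chi_of_thm1_rows` with (O⁗χ) ↦ (O⁗χ-R7): the supplier's record rows :=
collar + the `γ₀`-tolerance row (for every positive tolerance `φ`) and per family∕`(γ, K)` := (O⁗χ-R7) for some pinned [7]-family whenever one exists (`B := max (max B₃ᵀ B₀) ½`;
`exists_small_window`). [cite: Balaban1985Variational, Thm 1 (6)–(8) pp.278–279, (7) p.278; Balaban1985UV3, (7) p.257, (40)–(42) p.266, (47) p.267, (67)–(71) p.273 and Thm 2 p.272] -/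
theorem pinnedPartsT3ACRecNestedR7V4Chi_of_thm1_rows {L : ℕ} (hL : 1 < L)
    (hT : ∃ a₀ a₁ B₃ : ℝ, 0 < a₀ ∧ 0 < a₁ ∧ 0 < B₃ ∧ Thm1GlobalMinAt L a₀ a₁ B₃)
    {B₀ A₀ A₁ : ℝ} (hA₀ : 0 < A₀) (hA₁ : 0 < A₁)
    (hrows : ∀ (B a₀ a₁ : ℝ), B₀ ≤ B → 1 ≤ 2 * B → 0 < a₀ → a₀ ≤ A₀ → 0 < a₁ → a₁ ≤ A₁ → B * a₁ ≤ a₀ →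
      (143 * ((((3 + 4 : ℕ) : ℝ)) ^ 2 / 4) ^ 2) * (2 * (B * a₁)) ≤ 1 / 3 →
      2 * (2 * (B * a₁)) ≤ 2 * deltaSU (Fin 2) / (((3 + 4) * L : ℕ) : ℝ) ^ 2 →
      Thm1GlobalMinAt L a₀ a₁ B →
      ∃ (b₁ p₁ : ℝ), ∀ (b₀ p₀ : ℝ), b₁ ≤ b₀ → p₁ ≤ p₀ → ∀ (φ : ℝ → ℝ), (∀ x : ℝ, 0 < x → 0 < φ x) →
        ∃ 𝔠 : AlphaConsts L (suGroupModel 2).N, 𝔠.b₀ = b₀ ∧ 𝔠.p₀ = p₀ ∧ 𝔠.B₃ = B ∧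
          4 * 𝔠.B₃ * (L : ℝ) ^ 2 * avgWindowFactor L ≤ 𝔠.C68 ∧
          Real.exp (𝔠.p₀ - 1) ≤ 3 * C0 3 * 𝔠.C68 * (𝔠.b₀ * Q0 𝔠.p₀) ∧
          (𝔠.b₀ * Q0 𝔠.p₀) * (2 * (L : ℝ) ^ 2 * avgWindowFactor L) ^ 2 ≤ 3 * C0 3 * 𝔠.C68 * a₁ ^ 2 ∧
          7 * L + 3 ≤ 𝔠.M₁ ∧
          𝔠.gamma0 ≤ ((φ 𝔠.C68 / (𝔠.b₀ * Q0 𝔠.p₀)) ^ 2) ^ 2 ∧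
          ∀ (F : T3Family) (hF : F.L = L) (γ : ℝ) (hγ : 0 < γ) (hγ1 : γ ≤ (min (hF ▸ 𝔠).gamma0 1) ^ 2) (K : ℕ),
            (∃ Ut : (k : ℕ) → GaugeField (F.P K) k (Matrix.specialUnitaryGroup (Fin 2) ℂ) →
                GaugeField (F.P K) 0 (Matrix.specialUnitaryGroup (Fin 2) ℂ),
              AlphaInputsT3AC.TrivMinimiserRowsT3 F (hF ▸ 𝔠) γ hγ hγ1 a₀ a₁ K Ut) →
            ∃ Ut : (k : ℕ) → GaugeField (F.P K) k (Matrix.specialUnitaryGroup (Fin 2) ℂ) →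
                GaugeField (F.P K) 0 (Matrix.specialUnitaryGroup (Fin 2) ℂ),
              AlphaInputsT3AC.TrivMinimiserRowsT3 F (hF ▸ 𝔠) γ hγ hγ1 a₀ a₁ K Ut ∧
                AlphaInputsT3AC.DataRowsT3NestedR7ChiSel F (hF ▸ 𝔠) γ hγ hγ1 K Ut) :
    AlphaInputsT3AC.PinnedPartsT3ACRecNestedR7V4Chi L := by
  obtain ⟨aT₀, aT₁, BT, haT₀, haT₁, hBT, hT⟩ := hT
  set B : ℝ := max (max BT B₀) (1 / 2) with hB_def
  have hBT_le : BT ≤ B := (le_max_left _ _).trans (le_max_left _ _)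
  have hB₀_le : B₀ ≤ B := (le_max_right _ _).trans (le_max_left _ _)
  have hBhalf : 1 / 2 ≤ B := le_max_right _ _
  have hBpos : 0 < B := lt_of_lt_of_le (by norm_num) hBhalf
  have h2B : 1 ≤ 2 * B := by linarith
  obtain ⟨a₀, a₁, ha₀, ha₀A, ha₁, ha₁A, hwin, hA3, hA2⟩ :=
    exists_small_window hL hBpos (lt_min hA₀ haT₀) (lt_min hA₁ haT₁)
  have hT' : Thm1GlobalMinAt L a₀ a₁ B :=
    MinimiserPin.thm1GlobalMinAt_mono
      (MinimiserPin.thm1GlobalMinAt_anti hT (ha₀A.trans (min_le_right _ _)) (ha₁A.trans (min_le_right _ _))) le_rfl hBT_le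
  obtain ⟨b₁, p₁, hrec⟩ := hrows B a₀ a₁ hB₀_le h2B ha₀ (ha₀A.trans (min_le_left _ _)) ha₁ (ha₁A.trans (min_le_left _ _))
    hwin hA3 hA2 hT'
  refine ⟨b₁, p₁, fun b₀ p₀ hb hp φ hφ => ?_⟩
  obtain ⟨𝔠, h1, h2, hB3, s1, s2, s3, hM₁, hg, hFO⟩ := hrec b₀ p₀ hb hp φ hφ
  refine ⟨𝔠, a₀, a₁, h1, h2, ha₀, ha₁, by rw [hB3]; exact hwin, by rw [hB3]; exact hA3, by rw [hB3]; exact hA2,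
    by rw [hB3]; exact h2B, s1, s2, s3, hM₁, hg, by rw [hB3]; exact hT', fun F hF => hFO F hF⟩

/-- ★★★ **THE v5p10 STUB TEXT AT EVERY ODD `L > 1` ⇐ ⟨v5kC∕v5kD's `stub_thm1In8GlobalMin` TEXT⟩ ∧ (∀ odd `L > 1`, THE R7 v4 SUPPLIER ROWS)** — at every odd block size a floor `B₀` and a
box `(0, A₀] × (0, A₁]` on which, for every profile and every positive tolerance `φ`, the record rows (collar, `C68`-rows, `γ₀ ≤ ((φ(C68)∕(b₀Q₀))²)²`) and, per family∕`(γ, K)`, ONE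
pinned nested-regular minimiser selection over the (7)-set (radii `ε₁` above the recording floor, the supplier's choice) with its [Balaban1985UV3] Sect. B–C χ-data (O⁗χ-R7) are served —
print's own shape: NO seam, NO numerals, NO (FL), NO floor on `L`. [cite: Balaban1985UV3, (5) p.256, (7) p.257, (47) p.267, (67)–(71) p.273 and Thm 2 p.272; Balaban1985Variational, Thm 1 (8) p.279, (7) p.278 and Prop 8 p.304] -/
theorem laneRecordsV4Chi_of_thm1In8_nestedR7DataRows_dL
    (hT8 : ∀ L : ℕ, Odd L → 1 < L → ∃ a₀ a₁ B₃ : ℝ, 0 < a₀ ∧ 0 < a₁ ∧ 0 < B₃ ∧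
      Thm1GlobalMinAt L a₀ a₁ B₃ ∧ MinimisersIn8At L a₀ a₁ B₃)
    (hrows : ∀ L : ℕ, Odd L → 1 < L → ∃ (B₀ A₀ A₁ : ℝ), 0 < A₀ ∧ 0 < A₁ ∧
      ∀ (B a₀ a₁ : ℝ), B₀ ≤ B → 1 ≤ 2 * B → 0 < a₀ → a₀ ≤ A₀ → 0 < a₁ → a₁ ≤ A₁ → B * a₁ ≤ a₀ →
        (143 * ((((3 + 4 : ℕ) : ℝ)) ^ 2 / 4) ^ 2) * (2 * (B * a₁)) ≤ 1 / 3 →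
        2 * (2 * (B * a₁)) ≤ 2 * deltaSU (Fin 2) / (((3 + 4) * L : ℕ) : ℝ) ^ 2 →
        Thm1GlobalMinAt L a₀ a₁ B →
        ∃ (b₁ p₁ : ℝ), ∀ (b₀ p₀ : ℝ), b₁ ≤ b₀ → p₁ ≤ p₀ → ∀ (φ : ℝ → ℝ), (∀ x : ℝ, 0 < x → 0 < φ x) →
          ∃ 𝔠 : AlphaConsts L (suGroupModel 2).N, 𝔠.b₀ = b₀ ∧ 𝔠.p₀ = p₀ ∧ 𝔠.B₃ = B ∧
            4 * 𝔠.B₃ * (L : ℝ) ^ 2 * avgWindowFactor L ≤ 𝔠.C68 ∧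
            Real.exp (𝔠.p₀ - 1) ≤ 3 * C0 3 * 𝔠.C68 * (𝔠.b₀ * Q0 𝔠.p₀) ∧
            (𝔠.b₀ * Q0 𝔠.p₀) * (2 * (L : ℝ) ^ 2 * avgWindowFactor L) ^ 2 ≤ 3 * C0 3 * 𝔠.C68 * a₁ ^ 2 ∧
            7 * L + 3 ≤ 𝔠.M₁ ∧
            𝔠.gamma0 ≤ ((φ 𝔠.C68 / (𝔠.b₀ * Q0 𝔠.p₀)) ^ 2) ^ 2 ∧
            ∀ (F : T3Family) (hF : F.L = L) (γ : ℝ) (hγ : 0 < γ) (hγ1 : γ ≤ (min (hF ▸ 𝔠).gamma0 1) ^ 2) (K : ℕ),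
              (∃ Ut : (k : ℕ) → GaugeField (F.P K) k (Matrix.specialUnitaryGroup (Fin 2) ℂ) →
                  GaugeField (F.P K) 0 (Matrix.specialUnitaryGroup (Fin 2) ℂ),
                AlphaInputsT3AC.TrivMinimiserRowsT3 F (hF ▸ 𝔠) γ hγ hγ1 a₀ a₁ K Ut) →
              ∃ Ut : (k : ℕ) → GaugeField (F.P K) k (Matrix.specialUnitaryGroup (Fin 2) ℂ) →
                  GaugeField (F.P K) 0 (Matrix.specialUnitaryGroup (Fin 2) ℂ),
                AlphaInputsT3AC.TrivMinimiserRowsT3 F (hF ▸ 𝔠) γ hγ hγ1 a₀ a₁ K Ut ∧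
                  AlphaInputsT3AC.DataRowsT3NestedR7ChiSel F (hF ▸ 𝔠) γ hγ hγ1 K Ut) :
    ∀ L : ℕ, Odd L → 1 < L → AlphaInputsT3ACv4RecChi L := by
  intro L hLo hL
  obtain ⟨a₀, a₁, B₃, ha₀, ha₁, hB₃, hT, -⟩ := hT8 L hLo hL
  obtain ⟨B₀, A₀, A₁, hA₀, hA₁, h⟩ := hrows L hLo hL
  exact alphaInputsT3ACv4RecChi_of_pinnedPartsRecNestedR7V4Chi_dL
    (pinnedPartsT3ACRecNestedR7V4Chi_of_thm1_rows hL ⟨a₀, a₁, B₃, ha₀, ha₁, hB₃, hT⟩ hA₀ hA₁ h)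

end Summit.QuantumFields.YangMills.Theorems.HistoryTailSelSupplier

end
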